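import Literature.AlgebraicGeometry.HodgeTheory.RationalHodgeClasses
import Literature.AlgebraicGeometry.Motives.AlgPointsProductProofs
import Literature.AlgebraicGeometry.Motives.VarietiesProperProofs
import Literature.AlgebraicGeometry.Motives.SegreEmbedding
import Literature.NumberTheory.Transcendental.AnalytificationFunctorialityProofs
import Mathlib.Geometry.Manifold.MFDeriv.SpecificFunctions
import Mathlib.Geometry.Manifold.IsManifold.Basic
import Mathlib.LinearAlgebra.Dimension.Constructions
import HarnessLib

/-!
# Stub `stub_hodgeModelProdBiholomorph` (S2b/E2; line `purity-sorted-hecke-envelope` /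
# `HeckeGraphChow` of crux `EndoscopicMiddleDegree.OrthogonalEnveloped`, stmt-HodgeConjecture-14300):
# a Hodge model of `X ⊗ X` is biholomorphic, over `(X ⊗ X)(ℂ) ≃ X(ℂ) × X(ℂ)`, to the square of a
# Hodge model of `X`

Registered skeleton: `HeckeGraphChow` of crux `OrthogonalEnveloped`; intended as the file
`Theorems/EndoscopicMiddleDegreeOrthogonalEnvelopedHodgeModelProdBiholomorph.lean` of the summit
(`--supports stmt-HodgeConjecture-14300`).

WHAT IS PROVED. For a smooth projective `X` of dimension `n` over `ℂ`, a Hodge model `A` of `X`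
(`Literature.AlgebraicGeometry.HodgeTheory.HodgeModel`: a complex manifold `A.carrier` charted on
`A.model` with a comparison map `A.toComplexPoints : A.carrier → X(ℂ)` which is THE analytification,
`Literature.NumberTheory.Transcendental.IsAnalytification`) and a Hodge model `B` of `X ⊗ X`
(the fibre product over `Spec ℂ`, of dimension `n + n`), the comparison map

  `h = (φ_A⁻¹ × φ_A⁻¹) ∘ Π ∘ φ_B : B.carrier ≃ₜ A.carrier × A.carrier`
  (`exists_prodComparison`; `φ_A = A.toComplexPoints`, `φ_B = B.toComplexPoints`,
  `Π = AlgPoints.prodEquiv : (X ⊗ X)(ℂ) ≃ₜ X(ℂ) × X(ℂ)`, a homeomorphism by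
  `AlgPoints.isHomeomorph_prodEquiv_holds`)

is a homeomorphism over `Π` (its components are `φ_A⁻¹ ∘ fst(ℂ) ∘ φ_B`, `φ_A⁻¹ ∘ snd(ℂ) ∘ φ_B`, and
`φ_A ∘ φ_A⁻¹ = id`, `toComplexPoints_homeomorph_symm_apply`), holomorphic for the product complex
structure on `A.carrier × A.carrier` (`mdifferentiable_homeomorph_symm_comp_map`: the two components
are holomorphic by the functoriality of the analytification for the algebraic projections
`fst`, `snd : X ⊗ X ⟶ X`, PROVED in the tree as `IsAnalytification.mdifferentiable_comp_map_holds`,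
Serre GAGA §2 n°5 p. 9; then `MDifferentiable.prodMk`), and — GRANTED the
Osgood-on-manifolds statement "a holomorphic homeomorphism between complex manifolds of the same
dimension has a holomorphic inverse" as a HYPOTHESIS (it is the neighbouring stub
`stub_symmHolomorphicOfHomeomorph`, not proved here) — with holomorphic inverse, the two manifolds
having model spaces `B.model`, `A.model × A.model` of dimension `n + n` (`finrank_model_eq`:
`IsAnalytification.finrank_eq`, `Module.finrank_prod`). This is the registered stub
`stub_hodgeModelProdBiholomorph`. No new definitions are introduced (the comparison homeomorphism is
packaged as the existence statement `exists_prodComparison`).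

Sources: J.-P. Serre, *Géométrie algébrique et géométrie analytique*, Ann. Inst. Fourier 6 (1956),
§2 n°5 (Prop. 2 and p. 9: analytification of products and of morphisms); B. Conrad, *Weil and
Grothendieck approaches to adelic points*, Enseign. Math. 58 (2012), Prop. 2.1 (topology of the
points of a fibre product).
-/

noncomputable section

-- The crux-workfile namespace `Summit.<P>.<Sub>.Cruxes.…` repeats `HodgeConjecture` (single-conjunct summit).
set_option linter.dupNamespace false

namespace Summit.HodgeConjecture.HodgeConjecture.Cruxes.OrthogonalEnveloped.HeckeGraphChow

open scoped Manifold ContDiff Topology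
open CategoryTheory MonoidalCategory CartesianMonoidalCategory
open Literature.AlgebraicGeometry.Motives (SchemeOver ComplexPoints IsSmoothProjective AlgPoints)
open Literature.AlgebraicGeometry.HodgeTheory (HodgeModel)
open Literature.NumberTheory.Transcendental (IsAnalytification)

section Construction

variable {n : ℕ} {X : SchemeOver ℂ} (A : HodgeModel n X) (B : HodgeModel (n + n) (X ⊗ X))

/-- **The comparison homeomorphism** `h = (φ_A⁻¹ × φ_A⁻¹) ∘ Π ∘ φ_B : B.carrier ≃ₜ A.carrier × A.carrier`
between a Hodge model `B` of `X ⊗ X` and the square of a Hodge model `A` of `X` exists, with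
components `φ_A⁻¹ ∘ fst(ℂ) ∘ φ_B` and `φ_A⁻¹ ∘ snd(ℂ) ∘ φ_B` (`φ_A`, `φ_B` the comparison
homeomorphisms onto the complex points, `IsAnalytification.homeomorph`;
`Π : (X ⊗ X)(ℂ) ≃ₜ X(ℂ) × X(ℂ)` the homeomorphism `AlgPoints.prodEquiv`,
`AlgPoints.isHomeomorph_prodEquiv_holds`, with components `fst(ℂ)`, `snd(ℂ)`).
[cite: SerreGAGA1956, §2 n°5] -/
theorem exists_prodComparison :
    ∃ h : B.carrier ≃ₜ A.carrier × A.carrier, ∀ b, h b =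
      (A.isAnalytification.homeomorph.symm (AlgPoints.map (fst X X) (B.toComplexPoints b)),
        A.isAnalytification.homeomorph.symm (AlgPoints.map (snd X X) (B.toComplexPoints b))) :=
  ⟨B.isAnalytification.homeomorph.trans
      ((IsHomeomorph.homeomorph _
          (AlgPoints.isHomeomorph_prodEquiv_holds (X := X) (Y := X) (L := ℂ))).trans
        (A.isAnalytification.homeomorph.symm.prodCongr A.isAnalytification.homeomorph.symm)),
    fun _ ↦ rfl⟩

/-- `φ_A ∘ φ_A⁻¹ = id` on `X(ℂ)`, spelt with `A.toComplexPoints` (the underlying function of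
`φ_A = A.isAnalytification.homeomorph`). [cite: SerreGAGA1956, §2 n°5] -/
theorem toComplexPoints_homeomorph_symm_apply (P : ComplexPoints X) :
    A.toComplexPoints (A.isAnalytification.homeomorph.symm P) = P :=
  A.isAnalytification.homeomorph.apply_symm_apply P

/-- **The analytification of an algebraic map `g : X ⊗ X ⟶ X` is holomorphic** (for `X` smooth
projective): `φ_A⁻¹ ∘ g(ℂ) ∘ φ_B : B.carrier → A.carrier` is holomorphic, by the functoriality of the
analytification (`IsAnalytification.mdifferentiable_comp_map_holds`; `X` and `X ⊗ X` are smooth of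
relative dimensions `n`, `n + n` and locally of finite type, being smooth projective,
`IsSmoothProjective.tensor_holds`, `IsSmoothProjective.isProper_holds`). Used with `g = fst, snd`.
[cite: SerreGAGA1956, §2 n°5 p. 9 (fonctorialité de X^h)] -/
theorem mdifferentiable_homeomorph_symm_comp_map (hX : IsSmoothProjective n X) (g : X ⊗ X ⟶ X) :
    MDifferentiable 𝓘(ℂ, B.model) 𝓘(ℂ, A.model)
      (fun b ↦ A.isAnalytification.homeomorph.symm (AlgPoints.map g (B.toComplexPoints b))) := by
  haveI : AlgebraicGeometry.IsProper X.hom := IsSmoothProjective.isProper_holds hX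
  haveI : AlgebraicGeometry.SmoothOfRelativeDimension n X.hom := hX.smoothOfRelativeDimension
  have hXX : IsSmoothProjective (n + n) (X ⊗ X) := IsSmoothProjective.tensor_holds hX hX
  haveI : AlgebraicGeometry.IsProper (X ⊗ X).hom := IsSmoothProjective.isProper_holds hXX
  haveI : AlgebraicGeometry.SmoothOfRelativeDimension (n + n) (X ⊗ X).hom :=
    hXX.smoothOfRelativeDimension
  refine IsAnalytification.mdifferentiable_comp_map_holds B.isAnalytification A.isAnalytification
    g _ ?_
  funext b
  simp only [Function.comp_apply, toComplexPoints_homeomorph_symm_apply]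

/-- The model spaces of `B` and of `A × A` have the same dimension `n + n`
(`IsAnalytification.finrank_eq`). [cite: SerreGAGA1956, §2 n°5] -/
theorem finrank_model_eq :
    Module.finrank ℂ B.model = Module.finrank ℂ (A.model × A.model) := by
  rw [Module.finrank_prod, B.isAnalytification.finrank_eq, A.isAnalytification.finrank_eq]

end Construction

/-- **Stub E2 (`stub_hodgeModelProdBiholomorph`) — a Hodge model of `X ⊗ X` is the square of a Hodge
model of `X`, up to a biholomorphism over `(X ⊗ X)(ℂ) ≃ X(ℂ) × X(ℂ)`, GRANTED Osgood on manifolds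
(the hypothesis: a holomorphic homeomorphism between boundaryless complex manifolds with model spaces
of equal dimension has a holomorphic inverse).** The comparison
`h = (φ_A⁻¹ ∘ fst(ℂ) ∘ φ_B, φ_A⁻¹ ∘ snd(ℂ) ∘ φ_B)` (`exists_prodComparison`) is a homeomorphism
(`AlgPoints.isHomeomorph_prodEquiv_holds`) over `AlgPoints.prodEquiv`
(`toComplexPoints_homeomorph_symm_apply`), holomorphic by functoriality of the analytification for
the algebraic projections (`mdifferentiable_homeomorph_symm_comp_map`, via
`IsAnalytification.mdifferentiable_comp_map_holds`, and `MDifferentiable.prodMk`), between manifolds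
of dimension `n + n` (`finrank_model_eq`); its inverse is holomorphic by the hypothesis, applied with
the models `𝓘(ℂ, B.model)` and `𝓘(ℂ, A.model).prod 𝓘(ℂ, A.model)` (boundaryless; the product of
holomorphic atlases is a holomorphic atlas). [cite: SerreGAGA1956, §2 n°5 Prop. 2 and p. 9] -/
theorem stub_hodgeModelProdBiholomorph :
    (∀ {E : Type} [NormedAddCommGroup E] [NormedSpace ℂ E] [FiniteDimensional ℂ E]
      {H : Type} [TopologicalSpace H] {I : ModelWithCorners ℂ E H} [I.Boundaryless]
      {M : Type} [TopologicalSpace M] [ChartedSpace H M] [IsManifold I 1 M]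
      {E' : Type} [NormedAddCommGroup E'] [NormedSpace ℂ E'] [FiniteDimensional ℂ E']
      {H' : Type} [TopologicalSpace H'] {I' : ModelWithCorners ℂ E' H'} [I'.Boundaryless]
      {M' : Type} [TopologicalSpace M'] [ChartedSpace H' M'] [IsManifold I' 1 M']
      (h : M ≃ₜ M'), Module.finrank ℂ E = Module.finrank ℂ E' →
      MDifferentiable I I' h → MDifferentiable I' I h.symm) →
    ∀ {n : ℕ} {X : SchemeOver ℂ} (_hX : IsSmoothProjective n X) (A : HodgeModel n X)
      (B : HodgeModel (n + n) (X ⊗ X)),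
      ∃ h : B.carrier ≃ₜ A.carrier × A.carrier,
        MDifferentiable 𝓘(ℂ, B.model) (𝓘(ℂ, A.model).prod 𝓘(ℂ, A.model)) h ∧
        MDifferentiable (𝓘(ℂ, A.model).prod 𝓘(ℂ, A.model)) 𝓘(ℂ, B.model) h.symm ∧
        ∀ b, (A.toComplexPoints (h b).1, A.toComplexPoints (h b).2) =
          AlgPoints.prodEquiv (B.toComplexPoints b) := by
  intro hO n X hX A B
  obtain ⟨h, happly⟩ := exists_prodComparison A B
  have hmd : MDifferentiable 𝓘(ℂ, B.model) (𝓘(ℂ, A.model).prod 𝓘(ℂ, A.model)) h := by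
    rw [show ⇑h = _ from funext happly]
    exact (mdifferentiable_homeomorph_symm_comp_map A B hX (fst X X)).prodMk
      (mdifferentiable_homeomorph_symm_comp_map A B hX (snd X X))
  refine ⟨h, hmd, hO h (finrank_model_eq A B) hmd, fun b ↦ ?_⟩
  rw [happly]
  simp only [toComplexPoints_homeomorph_symm_apply]
  rfl

end Summit.HodgeConjecture.HodgeConjecture.Cruxes.OrthogonalEnveloped.HeckeGraphChow

end
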